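import Mathlib
import Summits.Ventures.HodgeRepro2.Tier7.Line3.NumberFieldBoxCount

/-!
# Tier 7 — LINE 3 support: the hyperbolic count in `M⁻¹O_K` (`Line3/NumberFieldHyperbolicCount.lean`; t7-L1-p5, gen 1)

Route (R1) of the version-(ii) isolation (t7-x1 l. 14928 (3), p1 l. 14924) needs `count_bound` with the size
`(1 + |x|_{ι₂})(1 + |x|_{ι₃})`: «#{x ∈ M⁻¹O_F : |x|_{ι₁} ≤ B, (1 + |x|_{ι₂})(1 + |x|_{ι₃}) ≤ R} ≲ R log R» (the product of
absolute values gives an INFINITE set, STATUS l. 14914). `Line3/LatticeCount.lean` (p667606) proves it for an abstract lattice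
`span ℤ (range b) ⊂ ℝ³`; THIS FILE proves it directly for `M⁻¹O_K` in t7-x1's vocabulary (`Line3/NumberFieldBoxCount.lean`
p668054: `scaledIntegers M`, `lattice hK M`, the box count `ncard_le` / `exists_finset`), so no lattice-basis dictionary is
needed: for a totally real `K`, `M ≠ 0`, two distinct places `w₂ ≠ w₃` and a bound `B ≥ 0` at every other place,
  `#{x : M x integral, |x|_w ≤ B (w ∉ {w₂, w₃}), (1 + |x|_{w₂})(1 + |x|_{w₃}) ≤ R} ≤ 40 K₀ (2B + 3)^{n−2} R (1 + log₂ R)`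
(`ncard_le`; `K₀ = #(unit box of M⁻¹O_K)`, `n = #InfinitePlace K`), and the `count_bound` SHAPE of p1's `DominantSide`
(`exists_finset_rpow`): for every `ε > 0` a finset containing every such `x`, of cardinality `≤ C_ε (2B + 3)^{n−2} (1 + R)^{1+ε}`.
PROOF: dyadic slices `2^k ≤ 1 + |x|_{w₂} < 2^{k+1}`, `k ≤ log₂ ⌊R⌋₊` (`mem_dyadic`); slice `k` lies in x1's box with sides `B`
off `{w₂, w₃}`, `2^{k+1}` at `w₂`, `R / 2^k` at `w₃` (`dyadicSides`), whose count is `≤ K₀ (2^{k+2} + 3)(2R/2^k + 3)(2B+3)^{n−2}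
≤ 40 K₀ R (2B+3)^{n−2}` (`prod_sides_le`); `K + 1 ≤ 1 + log₂ R`. On the real objects: `K = E′⁺` (cubic, totally real: `n = 3`,
`w₂, w₃ = ι₂, ι₃`, `B = 1 + |κ₀|_{ι₁}` from x1's KappaDefiniteBound), `x = κ(γ) − κ₀ ∈ M⁻¹O_F` (the §2a dictionary, L3's).
Sorry-free; axioms: propext / Classical.choice / Quot.sound. §8(d): uses an L-value-free non-vanishing device: NO.
-/

namespace Summit.Ventures.HodgeRepro2.Tier7.Line3.NumberFieldHyperbolicCount

open NumberField Summit.Ventures.HodgeRepro2.Tier7.Line3.LatticeBoxCount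
  Summit.Ventures.HodgeRepro2.Tier7.Line3.NumberFieldBoxCount

variable {K : Type*} [Field K] [NumberField K]

/-! ## 1. Dyadic bookkeeping -/

/-- `2 ^ log₂ ⌊R⌋₊ ≤ R` for `R ≥ 1` -/
theorem two_pow_log_floor_le {R : ℝ} (hR : 1 ≤ R) : (2 : ℝ) ^ Nat.log 2 ⌊R⌋₊ ≤ R := by
  have h0 : ⌊R⌋₊ ≠ 0 := (Nat.floor_pos.mpr hR).ne'
  have h1 : 2 ^ Nat.log 2 ⌊R⌋₊ ≤ ⌊R⌋₊ := Nat.pow_log_le_self 2 h0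
  have h2 : ((⌊R⌋₊ : ℕ) : ℝ) ≤ R := Nat.floor_le (by linarith)
  calc (2 : ℝ) ^ Nat.log 2 ⌊R⌋₊ = ((2 ^ Nat.log 2 ⌊R⌋₊ : ℕ) : ℝ) := by push_cast; ring
    _ ≤ ((⌊R⌋₊ : ℕ) : ℝ) := by exact_mod_cast h1
    _ ≤ R := h2

/-- `R ≤ 2 ^ (log₂ ⌊R⌋₊ + 1)` -/
theorem le_two_pow_log_floor_succ (R : ℝ) : R ≤ (2 : ℝ) ^ (Nat.log 2 ⌊R⌋₊ + 1) := by
  have h1 : ⌊R⌋₊ < 2 ^ (Nat.log 2 ⌊R⌋₊ + 1) := Nat.lt_pow_succ_log_self (by norm_num) ⌊R⌋₊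
  have h2 : R < (⌊R⌋₊ : ℝ) + 1 := Nat.lt_floor_add_one R
  have h3 : ((⌊R⌋₊ : ℕ) : ℝ) + 1 ≤ (2 : ℝ) ^ (Nat.log 2 ⌊R⌋₊ + 1) := by exact_mod_cast h1
  linarith

/-! ## 2. The region and the dyadic boxes -/

/-- the hyperbolic region in `M⁻¹O_K`: `|x|_w ≤ B` off `{w₂, w₃}` and `(1 + |x|_{w₂})(1 + |x|_{w₃}) ≤ R` -/
def hypSet (M : K) (w₂ w₃ : InfinitePlace K) (B R : ℝ) : Set K :=
  {x | IsIntegral ℤ (M * x) ∧ (∀ w : InfinitePlace K, w ≠ w₂ → w ≠ w₃ → w x ≤ B) ∧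
    (1 + w₂ x) * (1 + w₃ x) ≤ R}

open scoped Classical in
/-- the sides of the `k`-th dyadic box: `2^{k+1}` at `w₂`, `R / 2^k` at `w₃`, `B` elsewhere -/
noncomputable def dyadicSides (w₂ w₃ : InfinitePlace K) (B R : ℝ) (k : ℕ) : InfinitePlace K → ℝ :=
  fun w => if w = w₂ then (2 : ℝ) ^ (k + 1) else if w = w₃ then R / 2 ^ k else B

omit [NumberField K] in
/-- the sides at `w₂` -/
theorem dyadicSides_w₂ (w₂ w₃ : InfinitePlace K) (B R : ℝ) (k : ℕ) :
    dyadicSides w₂ w₃ B R k w₂ = (2 : ℝ) ^ (k + 1) := by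
  simp [dyadicSides]

omit [NumberField K] in
/-- the sides at `w₃` -/
theorem dyadicSides_w₃ {w₂ w₃ : InfinitePlace K} (hw : w₂ ≠ w₃) (B R : ℝ) (k : ℕ) :
    dyadicSides w₂ w₃ B R k w₃ = R / 2 ^ k := by
  simp [dyadicSides, hw.symm]

omit [NumberField K] in
/-- the sides elsewhere -/
theorem dyadicSides_other {w₂ w₃ w : InfinitePlace K} (h₂ : w ≠ w₂) (h₃ : w ≠ w₃) (B R : ℝ) (k : ℕ) :
    dyadicSides w₂ w₃ B R k w = B := by
  simp [dyadicSides, h₂, h₃]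

omit [NumberField K] in
/-- the sides are non-negative -/
theorem dyadicSides_nonneg {w₂ w₃ : InfinitePlace K} (hw : w₂ ≠ w₃) {B R : ℝ} (hB : 0 ≤ B) (hR : 0 ≤ R)
    (k : ℕ) (w : InfinitePlace K) : 0 ≤ dyadicSides w₂ w₃ B R k w := by
  by_cases h₂ : w = w₂
  · subst h₂; rw [dyadicSides_w₂]; positivity
  by_cases h₃ : w = w₃
  · subst h₃; rw [dyadicSides_w₃ hw]; positivity
  rw [dyadicSides_other h₂ h₃]; exact hB

omit [NumberField K] in
/-- every point of the region lies in a dyadic box with `k ≤ log₂ ⌊R⌋₊` -/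
theorem mem_dyadic {M : K} {w₂ w₃ : InfinitePlace K} (hw : w₂ ≠ w₃) {B R : ℝ} (hR : 1 ≤ R) {x : K}
    (hx : x ∈ hypSet M w₂ w₃ B R) :
    ∃ k ∈ Finset.range (Nat.log 2 ⌊R⌋₊ + 1),
      IsIntegral ℤ (M * x) ∧ ∀ w : InfinitePlace K, w x ≤ dyadicSides w₂ w₃ B R k w := by
  obtain ⟨hint, hoff, h23⟩ := hx
  set t : ℝ := 1 + w₂ x with ht
  have ht1 : 1 ≤ t := by have := apply_nonneg w₂ x; linarith
  have ht0 : 0 < t := by linarith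
  have hs1 : 1 ≤ 1 + w₃ x := by have := apply_nonneg w₃ x; linarith
  have htR : t ≤ R := by nlinarith
  set k : ℕ := Nat.log 2 ⌊t⌋₊ with hk
  have h2k : (2 : ℝ) ^ k ≤ t := two_pow_log_floor_le ht1
  have ht2k : t ≤ 2 ^ (k + 1) := le_two_pow_log_floor_succ t
  have hkK : k ≤ Nat.log 2 ⌊R⌋₊ := Nat.log_mono_right (Nat.floor_mono htR)
  refine ⟨k, Finset.mem_range.mpr (by omega), hint, fun w => ?_⟩
  have h2kpos : (0 : ℝ) < 2 ^ k := by positivity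
  by_cases hw₂ : w = w₂
  · subst hw₂
    rw [dyadicSides_w₂]
    linarith
  by_cases hw₃ : w = w₃
  · subst hw₃
    rw [dyadicSides_w₃ hw]
    have h1 : 1 + w x ≤ R / t := by
      rw [le_div_iff₀ ht0]
      linarith [mul_comm t (1 + w x)]
    have h2 : R / t ≤ R / 2 ^ k := div_le_div_of_nonneg_left (by linarith) h2kpos h2k
    have := apply_nonneg w x
    linarith
  rw [dyadicSides_other hw₂ hw₃]
  exact hoff w hw₂ hw₃

/-! ## 3. The product of the sides of a dyadic box -/

/-- `∏_w (2 · sides_w + 3) ≤ 40 R (2B + 3)^{n−2}` when `2^k ≤ R` -/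
theorem prod_sides_le {w₂ w₃ : InfinitePlace K} (hw : w₂ ≠ w₃) {B R : ℝ} (hB : 0 ≤ B) (hR : 1 ≤ R)
    {k : ℕ} (hk : (2 : ℝ) ^ k ≤ R) :
    ∏ w : InfinitePlace K, (2 * dyadicSides w₂ w₃ B R k w + 3) ≤
      40 * R * (2 * B + 3) ^ (Fintype.card (InfinitePlace K) - 2) := by
  classical
  set f : InfinitePlace K → ℝ := fun w => 2 * dyadicSides w₂ w₃ B R k w + 3 with hf
  have h2 : w₃ ∈ Finset.univ.erase w₂ := Finset.mem_erase.mpr ⟨hw.symm, Finset.mem_univ _⟩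
  rw [← Finset.mul_prod_erase Finset.univ f (Finset.mem_univ w₂), ← Finset.mul_prod_erase _ f h2]
  have hf2 : f w₂ = 2 * 2 ^ (k + 1) + 3 := by rw [hf]; simp only [dyadicSides_w₂]
  have hf3 : f w₃ = 2 * (R / 2 ^ k) + 3 := by rw [hf]; simp only [dyadicSides_w₃ hw]
  have hrest : ∏ w ∈ (Finset.univ.erase w₂).erase w₃, f w =
      ∏ _w ∈ (Finset.univ.erase w₂).erase w₃, (2 * B + 3) :=
    Finset.prod_congr rfl fun w hw' => by
      rw [Finset.mem_erase, Finset.mem_erase] at hw'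
      rw [hf]
      simp only [dyadicSides_other hw'.2.1 hw'.1]
  have hcard : ((Finset.univ.erase w₂).erase w₃).card = Fintype.card (InfinitePlace K) - 2 := by
    rw [Finset.card_erase_of_mem h2, Finset.card_erase_of_mem (Finset.mem_univ _), Finset.card_univ]
    omega
  rw [hrest, Finset.prod_const, hcard, hf2, hf3]
  have h2kpos : (0 : ℝ) < 2 ^ k := by positivity
  have hA : (2 : ℝ) * 2 ^ (k + 1) + 3 ≤ 2 ^ (k + 3) := by
    have h4 : (4 : ℝ) ≤ 2 ^ (k + 2) := by
      calc (4 : ℝ) = 2 ^ 2 := by norm_num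
        _ ≤ 2 ^ (k + 2) := pow_le_pow_right₀ (by norm_num) (by omega)
    have e1 : (2 : ℝ) ^ (k + 3) = 2 ^ (k + 2) * 2 := pow_succ 2 (k + 2)
    have e2 : (2 : ℝ) ^ (k + 2) = 2 ^ (k + 1) * 2 := pow_succ 2 (k + 1)
    rw [e1, e2]
    nlinarith
  have hB' : 2 * (R / 2 ^ k) + 3 ≤ 5 * (R / 2 ^ k) := by
    have : 1 ≤ R / 2 ^ k := by
      rw [le_div_iff₀ h2kpos]
      linarith
    linarith
  have hprod : (2 : ℝ) ^ (k + 3) * (5 * (R / 2 ^ k)) = 40 * R := by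
    have e1 : (2 : ℝ) ^ (k + 3) = 2 ^ k * 8 := by rw [pow_add]; norm_num
    rw [e1]
    field_simp
    ring
  have hBpow : (0 : ℝ) ≤ (2 * B + 3) ^ (Fintype.card (InfinitePlace K) - 2) := by positivity
  have hRk : (0 : ℝ) ≤ 2 * (R / 2 ^ k) + 3 := by
    have : (0 : ℝ) ≤ R / 2 ^ k := div_nonneg (by linarith) h2kpos.le
    linarith
  calc (2 * 2 ^ (k + 1) + 3) * ((2 * (R / 2 ^ k) + 3) * (2 * B + 3) ^ (Fintype.card (InfinitePlace K) - 2))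
      ≤ 2 ^ (k + 3) * ((5 * (R / 2 ^ k)) * (2 * B + 3) ^ (Fintype.card (InfinitePlace K) - 2)) :=
        mul_le_mul hA (mul_le_mul_of_nonneg_right hB' hBpow) (mul_nonneg hRk hBpow) (by positivity)
    _ = 40 * R * (2 * B + 3) ^ (Fintype.card (InfinitePlace K) - 2) := by rw [← mul_assoc, hprod]

/-! ## 4. THE HYPERBOLIC COUNT in `M⁻¹O_K` -/

open scoped Classical in
/-- **the hyperbolic count**: for a totally real `K`, `M ≠ 0`, distinct places `w₂ ≠ w₃`, `B ≥ 0`, `R ≥ 1`,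
`#{x ∈ M⁻¹O_K : |x|_w ≤ B (w ∉ {w₂, w₃}), (1 + |x|_{w₂})(1 + |x|_{w₃}) ≤ R} ≤ 40 K₀ (2B + 3)^{n−2} R (1 + log₂ R)`
with `K₀ = #(unit box of M⁻¹O_K)` and `n = #(InfinitePlace K)` -/
theorem ncard_le (hK : ∀ w : InfinitePlace K, w.IsReal) (M : K) (hM : M ≠ 0) {w₂ w₃ : InfinitePlace K}
    (hw : w₂ ≠ w₃) {B R : ℝ} (hB : 0 ≤ B) (hR : 1 ≤ R) :
    ((hypSet M w₂ w₃ B R).ncard : ℝ) ≤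
      40 * ((unitBox (lattice hK M)).ncard : ℝ) * (2 * B + 3) ^ (Fintype.card (InfinitePlace K) - 2) * R *
        (1 + Real.logb 2 R) := by
  set K₀ : ℝ := ((unitBox (lattice hK M)).ncard : ℝ) with hK₀
  have hK₀0 : 0 ≤ K₀ := by positivity
  set N : ℕ := Nat.log 2 ⌊R⌋₊ with hN
  -- the dyadic box finsets of x1's `exists_finset`
  have hbox : ∀ k : ℕ, ∃ s : Finset K,
      (∀ x, IsIntegral ℤ (M * x) → (∀ w : InfinitePlace K, w x ≤ dyadicSides w₂ w₃ B R k w) → x ∈ s) ∧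
      (s.card : ℝ) ≤ K₀ * ∏ w : InfinitePlace K, (2 * dyadicSides w₂ w₃ B R k w + 3) :=
    fun k => NumberFieldBoxCount.exists_finset hK M hM (dyadicSides w₂ w₃ B R k)
      (dyadicSides_nonneg hw hB (by linarith) k)
  choose s hs_mem hs_card using hbox
  set T : Finset K := (Finset.range (N + 1)).biUnion s with hT
  have hsub : hypSet M w₂ w₃ B R ⊆ ↑T := by
    intro x hx
    obtain ⟨k, hk, hint, hsides⟩ := mem_dyadic hw hR hx
    rw [hT, Finset.coe_biUnion, Set.mem_iUnion₂]
    exact ⟨k, hk, hs_mem k x hint hsides⟩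
  have h1 : (hypSet M w₂ w₃ B R).ncard ≤ T.card := by
    have := Set.ncard_le_ncard hsub T.finite_toSet
    rwa [Set.ncard_coe_finset] at this
  have h2 : T.card ≤ ∑ k ∈ Finset.range (N + 1), (s k).card := Finset.card_biUnion_le
  have h3 : ∀ k ∈ Finset.range (N + 1),
      ((s k).card : ℝ) ≤ K₀ * (40 * R * (2 * B + 3) ^ (Fintype.card (InfinitePlace K) - 2)) := by
    intro k hk
    have hk' : k ≤ N := Nat.lt_succ_iff.mp (Finset.mem_range.mp hk)
    have h2k : (2 : ℝ) ^ k ≤ R :=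
      (pow_le_pow_right₀ (by norm_num : (1 : ℝ) ≤ 2) hk').trans (two_pow_log_floor_le hR)
    exact (hs_card k).trans (mul_le_mul_of_nonneg_left (prod_sides_le hw hB hR h2k) hK₀0)
  have h4 : (∑ k ∈ Finset.range (N + 1), ((s k).card : ℝ)) ≤
      ((N : ℝ) + 1) * (K₀ * (40 * R * (2 * B + 3) ^ (Fintype.card (InfinitePlace K) - 2))) := by
    have := Finset.sum_le_sum h3
    rw [Finset.sum_const, Finset.card_range, nsmul_eq_mul] at this
    push_cast at this
    exact this
  have hN1 : (N : ℝ) ≤ Real.logb 2 R := by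
    rw [Real.le_logb_iff_rpow_le (by norm_num) (by linarith), Real.rpow_natCast]
    exact two_pow_log_floor_le hR
  have hpos : (0 : ℝ) ≤ K₀ * (40 * R * (2 * B + 3) ^ (Fintype.card (InfinitePlace K) - 2)) :=
    mul_nonneg hK₀0 (mul_nonneg (by linarith) (by positivity))
  calc ((hypSet M w₂ w₃ B R).ncard : ℝ) ≤ (T.card : ℝ) := by exact_mod_cast h1
    _ ≤ ∑ k ∈ Finset.range (N + 1), ((s k).card : ℝ) := by exact_mod_cast h2
    _ ≤ ((N : ℝ) + 1) * (K₀ * (40 * R * (2 * B + 3) ^ (Fintype.card (InfinitePlace K) - 2))) := h4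
    _ ≤ (1 + Real.logb 2 R) * (K₀ * (40 * R * (2 * B + 3) ^ (Fintype.card (InfinitePlace K) - 2))) :=
        mul_le_mul_of_nonneg_right (by linarith) hpos
    _ = 40 * K₀ * (2 * B + 3) ^ (Fintype.card (InfinitePlace K) - 2) * R * (1 + Real.logb 2 R) := by ring

open scoped Classical in
/-- the finset form with the `(1 + R)^{1+ε}` bound — the `count_bound` SHAPE of p1's `DominantSide` (row 674) for
`M⁻¹O_K` with the size `(1 + |x|_{w₂})(1 + |x|_{w₃})`: `β = 1 + ε` -/
theorem exists_finset_rpow (hK : ∀ w : InfinitePlace K, w.IsReal) (M : K) (hM : M ≠ 0)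
    {w₂ w₃ : InfinitePlace K} (hw : w₂ ≠ w₃) {ε : ℝ} (hε : 0 < ε) {B : ℝ} (hB : 0 ≤ B) :
    ∃ C : ℝ, 0 ≤ C ∧ ∀ R : ℝ, 1 ≤ R → ∃ s : Finset K,
      (∀ x, x ∈ hypSet M w₂ w₃ B R → x ∈ s) ∧ (s.card : ℝ) ≤ C * (1 + R) ^ (1 + ε) := by
  set K₀ : ℝ := ((unitBox (lattice hK M)).ncard : ℝ) with hK₀
  have hK₀0 : 0 ≤ K₀ := by positivity
  have hlog2 : 0 < Real.log 2 := Real.log_pos (by norm_num)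
  have hpos : 0 < ε * Real.log 2 := mul_pos hε hlog2
  set C₁ : ℝ := 40 * K₀ * (2 * B + 3) ^ (Fintype.card (InfinitePlace K) - 2) with hC₁
  have hC₁0 : 0 ≤ C₁ := by positivity
  refine ⟨C₁ * (1 + 1 / (ε * Real.log 2)), by positivity, fun R hR => ?_⟩
  -- the region is finite (it lies in the finite union of the dyadic boxes of `ncard_le`'s proof); re-use `ncard_le`
  -- through a finset that contains it: x1's `exists_finset` for the box of sides `R` everywhere contains it
  have hbox : ∃ s : Finset K,
      (∀ x, IsIntegral ℤ (M * x) → (∀ w : InfinitePlace K, w x ≤ max B R) → x ∈ s) ∧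
      (s.card : ℝ) ≤ K₀ * ∏ w : InfinitePlace K, (2 * max B R + 3) :=
    NumberFieldBoxCount.exists_finset hK M hM (fun _ => max B R) (fun _ => le_max_of_le_right (by linarith))
  obtain ⟨s₀, hs₀, _⟩ := hbox
  have hfin : (hypSet M w₂ w₃ B R).Finite := by
    refine s₀.finite_toSet.subset fun x hx => ?_
    obtain ⟨hint, hoff, h23⟩ := hx
    have hs1 : 1 ≤ 1 + w₃ x := by have := apply_nonneg w₃ x; linarith
    have hs2 : 1 ≤ 1 + w₂ x := by have := apply_nonneg w₂ x; linarith
    refine hs₀ x hint fun w => ?_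
    by_cases hw₂ : w = w₂
    · subst hw₂
      have : 1 + w x ≤ R := by nlinarith
      exact le_max_of_le_right (by linarith)
    by_cases hw₃ : w = w₃
    · subst hw₃
      have : 1 + w x ≤ R := by nlinarith
      exact le_max_of_le_right (by linarith)
    exact le_max_of_le_left (hoff w hw₂ hw₃)
  refine ⟨hfin.toFinset, fun x hx => hfin.mem_toFinset.mpr hx, ?_⟩
  rw [← Set.ncard_eq_toFinset_card _ hfin]
  have h1 := ncard_le hK M hM hw hB hR
  -- `R (1 + log₂ R) ≤ (1 + 1/(ε log 2)) (1 + R)^{1+ε}`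
  have hR0 : 0 < R := by linarith
  have hlogb : Real.logb 2 R ≤ R ^ ε / (ε * Real.log 2) := by
    have h := Real.log_le_rpow_div hR0.le hε
    rw [le_div_iff₀ hε] at h
    rw [Real.logb, div_le_div_iff₀ hlog2 hpos]
    nlinarith [hlog2]
  have hRe : R ^ (1 + ε) ≤ (1 + R) ^ (1 + ε) := Real.rpow_le_rpow hR0.le (by linarith) (by linarith)
  have hR1 : R ≤ (1 + R) ^ (1 + ε) := by
    calc R = R ^ (1 : ℝ) := (Real.rpow_one R).symm
      _ ≤ R ^ (1 + ε) := Real.rpow_le_rpow_of_exponent_le hR (by linarith)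
      _ ≤ (1 + R) ^ (1 + ε) := hRe
  have hmul : R * R ^ ε = R ^ (1 + ε) := by rw [Real.rpow_add hR0, Real.rpow_one]
  have h2 : R * (1 + Real.logb 2 R) ≤ (1 + 1 / (ε * Real.log 2)) * (1 + R) ^ (1 + ε) := by
    calc R * (1 + Real.logb 2 R) ≤ R * (1 + R ^ ε / (ε * Real.log 2)) := by
          apply mul_le_mul_of_nonneg_left _ hR0.le
          linarith
      _ = R + R ^ (1 + ε) / (ε * Real.log 2) := by rw [mul_add, mul_one, mul_div_assoc', hmul]
      _ ≤ (1 + R) ^ (1 + ε) + (1 + R) ^ (1 + ε) / (ε * Real.log 2) :=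
          add_le_add hR1 (div_le_div_of_nonneg_right hRe hpos.le)
      _ = (1 + 1 / (ε * Real.log 2)) * (1 + R) ^ (1 + ε) := by ring
  calc ((hypSet M w₂ w₃ B R).ncard : ℝ)
      ≤ 40 * K₀ * (2 * B + 3) ^ (Fintype.card (InfinitePlace K) - 2) * R * (1 + Real.logb 2 R) := h1
    _ = C₁ * (R * (1 + Real.logb 2 R)) := by rw [hC₁]; ring
    _ ≤ C₁ * ((1 + 1 / (ε * Real.log 2)) * (1 + R) ^ (1 + ε)) := mul_le_mul_of_nonneg_left h2 hC₁0
    _ = C₁ * (1 + 1 / (ε * Real.log 2)) * (1 + R) ^ (1 + ε) := by ring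

end Summit.Ventures.HodgeRepro2.Tier7.Line3.NumberFieldHyperbolicCount
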